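import Summits.NavierStokesRegularity.FluidComputer.PalasekTowerFaceLayerAtEnvelope

/-!
# REGISTER v2.3′ AT ARBITRARY RATES, V: the R-generic face layer, part III — TRANSFER («one continuation per stage
# suffices») for the readout schema and the three floors at `(R, k)`, and the `∃`-form entries of `HeredityAtGAt R k`

Cell `ns-blowup`, seat `ns-blowup-fc-prover-2` (g9). Companion of `PalasekTowerFaceLayerAt{,Envelope}.lean` (planner g23
typing ask, STATUS 2026-08-27T10:55Z (iii)). LABEL: E–C typing (KERNEL glue; no `Prop` introduced). WHAT THIS IS NOT:
not Navier–Stokes evidence — verbatim ports at `(R, k)` of `ReadoutAt.of_exists` / `ReadoutAt.iff_exists` and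
`SpeedFloorAt.of_exists` / `StrainFloorAt.of_exists` / `CoreFloorAt.of_exists` (`PalasekTowerRegisterGlobalFloorsAt.lean`
§1–§2): the helper `Stage.velocity_eq_of_window_ceiling` (forced Serrin–Masuda weak–strong uniqueness, no W14) is generic in
the rates already; nothing inhabited, no item filed or re-worded.

* `ReadoutGAt.of_exists` — if every registered level-`k` stage of a pinned rigid quiet design on `R` has SOME finite-energy
  classical continuation on `[0, τ (k+1)]` agreeing with it IN VELOCITY on `[0, τ k]`, inside the ceiling `c₂ Y_{k+1}` and
  with property `P` at `τ (k+1)`, then `ReadoutGAt R k P` (any other tame continuation has the same velocity);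
  `ReadoutGAt.iff_exists` under `ContinuationEnvelopeGAt R k`;
* `SpeedFloorGAt.of_exists`, `StrainFloorGAt.of_exists`, `CoreFloorGAt.of_exists`, `ReadoutFloorsGAt.of_exists`;
* `heredityAtGAt_of_exists_velocity_continuation` — ONE tame continuation per registered stage meeting the three floors of
  level `k + 1` at `τ (k+1)` gives `HeredityAtGAt R k` for `k ≥ 1` (the cheapest honest signature for a prover or a
  certificate on the re-based cruxes 20304 `HeredityAtOneT` / 20305 `HeredityFromTwoT`).

References: H. Sohr, *The Navier–Stokes Equations*, Birkhäuser 2001, Ch. V Thm. 1.5.1 [cite: Sohr2001, Ch. V Thm. 1.5.1];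
S. Palasek, arXiv:2605.13827 §4 [cite: Palasek2026ElementaryModel, §4].
-/

noncomputable section

namespace Summit.NavierStokesRegularity.FluidComputer.PalasekTowerClayBridge

open Set MeasureTheory Filter Topology Function Real
open scoped ENNReal ContDiff NNReal
open Literature.Analysis.FluidPDE
open Summit.NavierStokesRegularity.NavierStokesRegularity

variable {R : TowerRates}

namespace ReadoutGAt

variable {k : ℕ} {P : Schedule R → (EuclideanSpace ℝ (Fin 3) → EuclideanSpace ℝ (Fin 3)) → Prop}

/-- **TRANSFER — one continuation per stage suffices.** If every registered level-`k` stage of a pinned rigid quiet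
design on `R` has SOME finite-energy classical solution `(v, q)` of the design's system on `[0, τ (k+1)]`, agreeing with
the stage IN VELOCITY on `[0, τ k]`, inside the ceiling `c₂ Y_{k+1}` and with property `P` at `τ (k+1)`, then
`ReadoutGAt R k P`: any other tame continuation has the same velocity on `[0, τ (k+1)]`
(`Stage.velocity_eq_of_window_ceiling` — the ceiling makes both the bounded = strong solution; forced Serrin–Masuda, no
W14). [cite: Sohr2001, Ch. V Thm. 1.5.1] -/
theorem of_exists
    (h : ∀ S : Schedule R, S.Pins 8 (6 / 5) → S.Rigid → S.Quiet →
      ∀ s : Stage 1 R S (Margins.routeG R) k,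
        ∃ (v : ℝ → EuclideanSpace ℝ (Fin 3) → EuclideanSpace ℝ (Fin 3))
          (q : ℝ → EuclideanSpace ℝ (Fin 3) → ℝ),
          IsClassicalNSSolutionOn (Icc 0 (S.τ (k + 1))) 1 S.f v q ∧
          (∀ t ∈ Icc 0 (S.τ k), v t = s.u t) ∧
          (∃ C : ℝ≥0∞, C < ⊤ ∧ ∀ t ∈ Icc 0 (S.τ (k + 1)), ∫⁻ x, ‖v t x‖ₑ ^ 2 ≤ C) ∧
          (∀ t ∈ Icc 0 (S.τ (k + 1)), ∀ x, ‖v t x‖ ≤ S.c₂ * R.Y (k + 1)) ∧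
          P S (v (S.τ (k + 1)))) :
    ReadoutGAt R k P := by
  intro S hP hR hQ s u p hcl hagree henergy hceil
  obtain ⟨v, q, hvcl, hvagree, hvenergy, hvceil, hPv⟩ := h S hP hR hQ s
  have h0 : (0 : ℝ) ∈ Icc 0 (S.τ k) := ⟨le_rfl, (S.τ_pos k).le⟩
  have hu0 : u 0 = S.u₀ := ((hagree 0 h0).1).trans s.initial
  have hv0 : v 0 = S.u₀ := (hvagree 0 h0).trans s.initial
  have heq : ∀ t ∈ Icc 0 (S.τ (k + 1)), u t = v t :=
    s.velocity_eq_of_window_ceiling one_pos hvcl hv0 hvenergy (fun t ht x => hvceil t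
      ⟨(S.τ_pos k).le.trans ht.1, ht.2⟩ x) hcl hu0 henergy
  have hτ : S.τ (k + 1) ∈ Icc 0 (S.τ (k + 1)) := ⟨(S.τ_pos (k + 1)).le, le_rfl⟩
  rw [heq (S.τ (k + 1)) hτ]
  exact hPv

/-- **Under the upper half the schema IS an `∃`-statement**: given `ContinuationEnvelopeGAt R k`, `ReadoutGAt R k P`
holds iff every registered level-`k` stage has a tame continuation (velocity agreement) with property `P` at `τ (k+1)`.
[cite: Sohr2001, Ch. V Thm. 1.5.1] -/
theorem iff_exists (hE : ContinuationEnvelopeGAt R k) :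
    ReadoutGAt R k P ↔
      ∀ S : Schedule R, S.Pins 8 (6 / 5) → S.Rigid → S.Quiet →
        ∀ s : Stage 1 R S (Margins.routeG R) k,
          ∃ (v : ℝ → EuclideanSpace ℝ (Fin 3) → EuclideanSpace ℝ (Fin 3))
            (q : ℝ → EuclideanSpace ℝ (Fin 3) → ℝ),
            IsClassicalNSSolutionOn (Icc 0 (S.τ (k + 1))) 1 S.f v q ∧
            (∀ t ∈ Icc 0 (S.τ k), v t = s.u t) ∧
            (∃ C : ℝ≥0∞, C < ⊤ ∧ ∀ t ∈ Icc 0 (S.τ (k + 1)), ∫⁻ x, ‖v t x‖ₑ ^ 2 ≤ C) ∧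
            (∀ t ∈ Icc 0 (S.τ (k + 1)), ∀ x, ‖v t x‖ ≤ S.c₂ * R.Y (k + 1)) ∧
            P S (v (S.τ (k + 1))) := by
  refine ⟨fun h S hP hR hQ s => ?_, of_exists⟩
  obtain ⟨u, p, hcl, hagree, henergy, hceil⟩ := hE S hP hR hQ s
  exact ⟨u, p, hcl, fun t ht => (hagree t ht).1, henergy, hceil,
    h S hP hR hQ s u p hcl hagree henergy hceil⟩

end ReadoutGAt

/-- **One good continuation per stage gives the speed floor at `(R, k)`** (transfer, no W14).
[cite: Sohr2001, Ch. V Thm. 1.5.1] -/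
theorem SpeedFloorGAt.of_exists {k : ℕ}
    (h : ∀ S : Schedule R, S.Pins 8 (6 / 5) → S.Rigid → S.Quiet →
      ∀ s : Stage 1 R S (Margins.routeG R) k,
        ∃ (v : ℝ → EuclideanSpace ℝ (Fin 3) → EuclideanSpace ℝ (Fin 3))
          (q : ℝ → EuclideanSpace ℝ (Fin 3) → ℝ),
          IsClassicalNSSolutionOn (Icc 0 (S.τ (k + 1))) 1 S.f v q ∧
          (∀ t ∈ Icc 0 (S.τ k), v t = s.u t) ∧
          (∃ C : ℝ≥0∞, C < ⊤ ∧ ∀ t ∈ Icc 0 (S.τ (k + 1)), ∫⁻ x, ‖v t x‖ₑ ^ 2 ≤ C) ∧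
          (∀ t ∈ Icc 0 (S.τ (k + 1)), ∀ x, ‖v t x‖ ≤ S.c₂ * R.Y (k + 1)) ∧
          ∃ x, ‖x‖ ≤ S.radius ∧ S.c₁ * R.Y (k + 1) ≤ ‖v (S.τ (k + 1)) x‖) :
    SpeedFloorGAt R k :=
  ReadoutGAt.of_exists h

/-- **One good continuation per stage gives the strain floor at `(R, k)`** (transfer, no W14).
[cite: Sohr2001, Ch. V Thm. 1.5.1] -/
theorem StrainFloorGAt.of_exists {k : ℕ}
    (h : ∀ S : Schedule R, S.Pins 8 (6 / 5) → S.Rigid → S.Quiet →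
      ∀ s : Stage 1 R S (Margins.routeG R) k,
        ∃ (v : ℝ → EuclideanSpace ℝ (Fin 3) → EuclideanSpace ℝ (Fin 3))
          (q : ℝ → EuclideanSpace ℝ (Fin 3) → ℝ),
          IsClassicalNSSolutionOn (Icc 0 (S.τ (k + 1))) 1 S.f v q ∧
          (∀ t ∈ Icc 0 (S.τ k), v t = s.u t) ∧
          (∃ C : ℝ≥0∞, C < ⊤ ∧ ∀ t ∈ Icc 0 (S.τ (k + 1)), ∫⁻ x, ‖v t x‖ₑ ^ 2 ≤ C) ∧
          (∀ t ∈ Icc 0 (S.τ (k + 1)), ∀ x, ‖v t x‖ ≤ S.c₂ * R.Y (k + 1)) ∧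
          ∃ x, ‖x‖ ≤ S.radius ∧ S.c₁ * R.A (k + 1) ≤ ‖fderiv ℝ (v (S.τ (k + 1))) x‖) :
    StrainFloorGAt R k :=
  ReadoutGAt.of_exists h

/-- **One good continuation per stage gives the core floor at `(R, k)`** (transfer, no W14).
[cite: Sohr2001, Ch. V Thm. 1.5.1] -/
theorem CoreFloorGAt.of_exists {k : ℕ}
    (h : ∀ S : Schedule R, S.Pins 8 (6 / 5) → S.Rigid → S.Quiet →
      ∀ s : Stage 1 R S (Margins.routeG R) k,
        ∃ (v : ℝ → EuclideanSpace ℝ (Fin 3) → EuclideanSpace ℝ (Fin 3))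
          (q : ℝ → EuclideanSpace ℝ (Fin 3) → ℝ),
          IsClassicalNSSolutionOn (Icc 0 (S.τ (k + 1))) 1 S.f v q ∧
          (∀ t ∈ Icc 0 (S.τ k), v t = s.u t) ∧
          (∃ C : ℝ≥0∞, C < ⊤ ∧ ∀ t ∈ Icc 0 (S.τ (k + 1)), ∫⁻ x, ‖v t x‖ₑ ^ 2 ≤ C) ∧
          (∀ t ∈ Icc 0 (S.τ (k + 1)), ∀ x, ‖v t x‖ ≤ S.c₂ * R.Y (k + 1)) ∧
          ∃ (x : EuclideanSpace ℝ (Fin 3)) (γ : ℝ → EuclideanSpace ℝ (Fin 3)),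
            ‖x‖ ≤ S.radius ∧ ContDiff ℝ 1 γ ∧ γ 0 = γ 1 ∧
            (∀ σ ∈ Icc (0 : ℝ) 1, γ σ ∈ Metric.closedBall x (1 / R.N (k + 1))) ∧
            (∀ σ ∈ Icc (0 : ℝ) 1, ‖deriv γ σ‖ ≤ 8 * π / R.N (k + 1)) ∧
            S.c₁ * R.N (k + 1) ^ (R.β - 2) ≤ circulation (v (S.τ (k + 1))) γ) :
    CoreFloorGAt R k :=
  ReadoutGAt.of_exists h

/-- **One good continuation per stage gives the whole lower half at `(R, k)`**: a tame continuation meeting the three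
floors of level `k + 1` at `τ (k+1)`. [cite: Sohr2001, Ch. V Thm. 1.5.1] -/
theorem ReadoutFloorsGAt.of_exists {k : ℕ}
    (h : ∀ S : Schedule R, S.Pins 8 (6 / 5) → S.Rigid → S.Quiet →
      ∀ s : Stage 1 R S (Margins.routeG R) k,
        ∃ (v : ℝ → EuclideanSpace ℝ (Fin 3) → EuclideanSpace ℝ (Fin 3))
          (q : ℝ → EuclideanSpace ℝ (Fin 3) → ℝ),
          IsClassicalNSSolutionOn (Icc 0 (S.τ (k + 1))) 1 S.f v q ∧
          (∀ t ∈ Icc 0 (S.τ k), v t = s.u t) ∧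
          (∃ C : ℝ≥0∞, C < ⊤ ∧ ∀ t ∈ Icc 0 (S.τ (k + 1)), ∫⁻ x, ‖v t x‖ₑ ^ 2 ≤ C) ∧
          (∀ t ∈ Icc 0 (S.τ (k + 1)), ∀ x, ‖v t x‖ ≤ S.c₂ * R.Y (k + 1)) ∧
          ((∃ x, ‖x‖ ≤ S.radius ∧ S.c₁ * R.Y (k + 1) ≤ ‖v (S.τ (k + 1)) x‖) ∧
           (∃ x, ‖x‖ ≤ S.radius ∧ S.c₁ * R.A (k + 1) ≤ ‖fderiv ℝ (v (S.τ (k + 1))) x‖) ∧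
           (∃ (x : EuclideanSpace ℝ (Fin 3)) (γ : ℝ → EuclideanSpace ℝ (Fin 3)),
              ‖x‖ ≤ S.radius ∧ ContDiff ℝ 1 γ ∧ γ 0 = γ 1 ∧
              (∀ σ ∈ Icc (0 : ℝ) 1, γ σ ∈ Metric.closedBall x (1 / R.N (k + 1))) ∧
              (∀ σ ∈ Icc (0 : ℝ) 1, ‖deriv γ σ‖ ≤ 8 * π / R.N (k + 1)) ∧
              S.c₁ * R.N (k + 1) ^ (R.β - 2) ≤ circulation (v (S.τ (k + 1))) γ))) :
    ReadoutFloorsGAt R k :=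
  ReadoutGAt.of_exists h

/-- **The `∃`-form entry of heredity at `(R, k)`, `k ≥ 1`**: if every registered level-`k` stage of a pinned rigid quiet
design on `R` has ONE finite-energy classical continuation on `[0, τ (k+1)]` (design force, VELOCITY agreement on
`[0, τ k]`, any pressure gauge) inside the ceiling `c₂ Y_{k+1}` and meeting the three floors of level `k + 1` at
`τ (k+1)`, then `HeredityAtGAt R k`. Proof: the continuation is the upper half (re-gauging the pressure,
`Stage.exists_pressure_regauge`) and, by transfer, the lower half; `heredityAtGAt_iff_envelope_and_floors`.
[cite: Sohr2001, Ch. V Thm. 1.5.1] -/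
theorem heredityAtGAt_of_exists_velocity_continuation {k : ℕ} (hk : 1 ≤ k)
    (h : ∀ S : Schedule R, S.Pins 8 (6 / 5) → S.Rigid → S.Quiet →
      ∀ s : Stage 1 R S (Margins.routeG R) k,
        ∃ (v : ℝ → EuclideanSpace ℝ (Fin 3) → EuclideanSpace ℝ (Fin 3))
          (q : ℝ → EuclideanSpace ℝ (Fin 3) → ℝ),
          IsClassicalNSSolutionOn (Icc 0 (S.τ (k + 1))) 1 S.f v q ∧
          (∀ t ∈ Icc 0 (S.τ k), v t = s.u t) ∧
          (∃ C : ℝ≥0∞, C < ⊤ ∧ ∀ t ∈ Icc 0 (S.τ (k + 1)), ∫⁻ x, ‖v t x‖ₑ ^ 2 ≤ C) ∧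
          (∀ t ∈ Icc 0 (S.τ (k + 1)), ∀ x, ‖v t x‖ ≤ S.c₂ * R.Y (k + 1)) ∧
          ((∃ x, ‖x‖ ≤ S.radius ∧ S.c₁ * R.Y (k + 1) ≤ ‖v (S.τ (k + 1)) x‖) ∧
           (∃ x, ‖x‖ ≤ S.radius ∧ S.c₁ * R.A (k + 1) ≤ ‖fderiv ℝ (v (S.τ (k + 1))) x‖) ∧
           (∃ (x : EuclideanSpace ℝ (Fin 3)) (γ : ℝ → EuclideanSpace ℝ (Fin 3)),
              ‖x‖ ≤ S.radius ∧ ContDiff ℝ 1 γ ∧ γ 0 = γ 1 ∧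
              (∀ σ ∈ Icc (0 : ℝ) 1, γ σ ∈ Metric.closedBall x (1 / R.N (k + 1))) ∧
              (∀ σ ∈ Icc (0 : ℝ) 1, ‖deriv γ σ‖ ≤ 8 * π / R.N (k + 1)) ∧
              S.c₁ * R.N (k + 1) ^ (R.β - 2) ≤ circulation (v (S.τ (k + 1))) γ))) :
    HeredityAtGAt R k := by
  refine (heredityAtGAt_iff_envelope_and_floors hk).2 ⟨?_, ReadoutFloorsGAt.of_exists h⟩
  intro S hP hR hQ s
  obtain ⟨v, q, hcl, hvel, hE, hceil, -⟩ := h S hP hR hQ s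
  have hτle : S.τ k ≤ S.τ (k + 1) := S.τ_mono (Nat.le_succ k)
  obtain ⟨P, hclP, hagree⟩ := s.exists_pressure_regauge hτle hcl hvel
  exact ⟨v, P, hclP, hagree, hE, hceil⟩

end Summit.NavierStokesRegularity.FluidComputer.PalasekTowerClayBridge

end
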